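import Literature.MathematicalPhysics.KineticTheory.HardSphereGibbsGNZIdentity

/-!
# Insertion-ratio bounds for the particle number under the free hard-sphere measure (line `FirstLemma`, crux stmt-AtomisticToContinuum-14135)

Registered stub `c9_free_count_succ_ratio_bounds` (lead seat c9, piece (B3) of the thermodynamic step of the Gibbs
route), namespace `Summit.AtomisticToContinuum.HydrodynamicLimit.Theorems.KiferCompactification`.

Let `γ = gibbsSpecMeasure 1 z β u Λ ∅` be the FREE finite-volume grand-canonical law of the unit-diameter hard-sphere
gas in a bounded measurable window `Λ ⊆ ℝ³` (activity `z > 0`, Maxwellian marks at `β > 0`, empty boundary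
condition), `N = #(all particles)` and `p_j = γ{N = j}`. Then for every `j`

`z (vol Λ - (4π/3) j)⁺ / (j + 1) · p_j ≤ p_{j+1} ≤ z vol Λ / (j + 1) · p_j`.

Proof. With `m = Leb|_Λ ⊗ M_β` the one-particle a-priori law (`m(univ) = vol Λ`) and
`I_k = m^{⊗k}{hard core}`, the event `{N = j}` is charged only by the `k = j` term of the weight series
(`m^{⊗k}`-a.s. the `k` thrown points are distinct with positions in `Λ`, so the superposition has exactly `k` points):
`γ{N = j} = W⁻¹ (z^j/j!) I_j` (`gibbsWeight_empty_countUniv_eq`). Integrating out one point,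
`I_{j+1} ≤ vol Λ · I_j` (`pi_hardCore_succ_le`) and, by the insertion identity `I_{j+1} = ∫_{hc} V(x) m^{⊗j}(dx)` with the
free volume `V(x) = m{p | no centre of x in B(p.1, 1)} ≥ vol(Λ ∖ ⋃ᵢ B(xᵢ, 1)) ≥ vol Λ - j · 4π/3`
(`pi_hardCore_succ_eq`, `EuclideanSpace.volume_ball_fin_three`), `I_{j+1} ≥ (vol Λ - (4π/3) j)⁺ I_j`. Finally
`(z^{j+1}/(j+1)!) = z/(j+1) · z^j/j!`.

References: D. Ruelle, *Statistical Mechanics: Rigorous Results* (1969), §3.4 and §4.2; D. Dereudre, *Introduction to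
the theory of Gibbs point processes*, LNM 2237 (2019), §2.5 (GNZ equation, insertion of one point).
-/

noncomputable section

open MeasureTheory ProbabilityTheory Set Filter Topology
open scoped ENNReal NNReal

namespace Summit.AtomisticToContinuum.HydrodynamicLimit.Theorems.KiferCompactification

open Literature.MathematicalPhysics.KineticTheory (V3)
open Literature.MathematicalPhysics.KineticTheory.HardSphereDLR (gibbsSpecMeasure gibbsWeightMeasure_apply
  mem_superposeIn_iff count_superposeIn_eq_of_injective gibbsWeight_univ_eq_tsum maxwellPhaseMeasure_univ
  maxwellPhaseMeasure_eq_prod sigmaFinite_maxwellPhaseMeasure isProbabilityMeasure_withDensity_maxwellianBeta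
  measurableSet_hardCoreIn_superposeIn_left ae_pi_maxwellPhaseMeasure_good pi_hardCore_succ_le pi_hardCore_succ_eq)
open Literature.Analysis.FluidPDE (HardCoreIn superposeIn gibbsWeight maxwellPhaseMeasure)
open Literature.Analysis.FunctionSpaces (PointConfig)

/-! ## Counting the particles of a free superposition -/

/-- The events `{N = n}` (`N` the total number of particles) are measurable. -/
theorem measurableSet_countUniv_eq (n : ℕ) :
    MeasurableSet {ω : PointConfig (V3 × V3) | ω.count univ = (n : ℕ∞)} :=
  (PointConfig.measurable_count MeasurableSet.univ) (measurableSet_singleton (n : ℕ∞))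

/-- Nothing belongs to the empty configuration. -/
private theorem notMem_emptyConfig_free (p : V3 × V3) : p ∉ (∅ : PointConfig (V3 × V3)) := fun hp =>
  absurd (show p ∈ (∅ : PointConfig (V3 × V3)).carrier from hp) (by simp)

/-- If the `k` thrown points are distinct with positions in `Λ`, the free superposition (empty boundary condition)
has exactly `k` particles in total. -/
theorem count_univ_superposeIn_empty {Λ : Set V3} {k : ℕ} {x : Fin k → V3 × V3} (hx : ∀ i, (x i).1 ∈ Λ)
    (hinj : Function.Injective x) : (superposeIn Λ x ∅).count univ = k := by
  rw [← count_superposeIn_eq_of_injective Λ hx hinj ∅]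
  unfold PointConfig.count
  congr 1
  ext p
  simp only [mem_inter_iff, mem_univ, and_true, mem_prod, PointConfig.mem_carrier]
  constructor
  · intro hp
    rcases (mem_superposeIn_iff Λ x ∅ p).1 hp with ⟨-, hpΛ⟩ | ⟨hp0, -⟩
    · exact ⟨hp, hpΛ⟩
    · exact absurd hp0 (notMem_emptyConfig_free p)
  · exact fun hp => hp.1

/-- **The event `{N = n}` is charged only by the `n`-th term of the free weight series**:
`weight_Λ({N = n} | ∅) = (zⁿ/n!) · m^{⊗n}{hard core}` (`m^{⊗k}`-a.s. the thrown points are distinct with positions in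
`Λ`, so the superposition of `k` thrown points has exactly `k` particles). -/
theorem gibbsWeight_empty_countUniv_eq (z β : ℝ) (u : V3) {Λ : Set V3} (hΛ : MeasurableSet Λ) (n : ℕ) :
    gibbsWeight 1 z β u Λ ∅ {ω | ω.count univ = (n : ℕ∞)} =
      ENNReal.ofReal (z ^ n / (Nat.factorial n)) *
        (Measure.pi fun _ : Fin n => maxwellPhaseMeasure β u Λ) {x | HardCoreIn 1 Λ (superposeIn Λ x ∅)} := by
  haveI := sigmaFinite_maxwellPhaseMeasure β u Λ
  have hterm : ∀ k : ℕ,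
      ∫⁻ x : Fin k → V3 × V3, ({ω : PointConfig (V3 × V3) | ω.count univ = (n : ℕ∞)} ∩
          {X | HardCoreIn 1 Λ X}).indicator 1 (superposeIn Λ x ∅) ∂(Measure.pi fun _ : Fin k => maxwellPhaseMeasure β u Λ) =
        if k = n then (Measure.pi fun _ : Fin k => maxwellPhaseMeasure β u Λ) {x | HardCoreIn 1 Λ (superposeIn Λ x ∅)}
        else 0 := by
    intro k
    have hgood := ae_pi_maxwellPhaseMeasure_good β u hΛ k
    by_cases hk : k = n
    · subst hk
      rw [if_pos rfl, ← lintegral_indicator_one (measurableSet_hardCoreIn_superposeIn_left 1 hΛ k ∅)]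
      refine lintegral_congr_ae (hgood.mono fun x hx => ?_)
      have hmem : superposeIn Λ x ∅ ∈ {ω : PointConfig (V3 × V3) | ω.count univ = (k : ℕ∞)} :=
        count_univ_superposeIn_empty hx.1 hx.2
      dsimp only
      by_cases hH : HardCoreIn 1 Λ (superposeIn Λ x ∅)
      · rw [indicator_of_mem (show superposeIn Λ x ∅ ∈ {ω : PointConfig (V3 × V3) | ω.count univ = (k : ℕ∞)} ∩
            {X | HardCoreIn 1 Λ X} from ⟨hmem, hH⟩),
          indicator_of_mem (show x ∈ {x : Fin k → V3 × V3 | HardCoreIn 1 Λ (superposeIn Λ x ∅)} from hH)]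
        rfl
      · rw [indicator_of_notMem (fun h : superposeIn Λ x ∅ ∈ {ω : PointConfig (V3 × V3) | ω.count univ = (k : ℕ∞)} ∩
            {X | HardCoreIn 1 Λ X} => hH h.2),
          indicator_of_notMem (show x ∉ {x : Fin k → V3 × V3 | HardCoreIn 1 Λ (superposeIn Λ x ∅)} from hH)]
    · rw [if_neg hk]
      refine (lintegral_congr_ae (hgood.mono fun x hx => ?_)).trans lintegral_zero
      refine indicator_of_notMem (fun h => hk ?_) _
      have h1 : (superposeIn Λ x ∅).count univ = (n : ℕ∞) := h.1
      rw [count_univ_superposeIn_empty hx.1 hx.2] at h1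
      exact_mod_cast h1
  unfold Literature.Analysis.FluidPDE.gibbsWeight
  rw [tsum_congr fun k => by rw [hterm k], tsum_eq_single n fun k hk => by rw [if_neg hk, mul_zero], if_pos rfl]

/-- The free law of the event `{N = n}`: `γ_Λ({N = n} | ∅) = W⁻¹ (zⁿ/n!) m^{⊗n}{hard core}`, `W` the normalising weight. -/
theorem gibbsSpecMeasure_empty_countUniv_eq (z β : ℝ) (u : V3) {Λ : Set V3} (hΛ : MeasurableSet Λ) (n : ℕ) :
    gibbsSpecMeasure 1 z β u Λ ∅ {ω | ω.count univ = (n : ℕ∞)} =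
      (gibbsWeight 1 z β u Λ ∅ univ)⁻¹ * (ENNReal.ofReal (z ^ n / (Nat.factorial n)) *
        (Measure.pi fun _ : Fin n => maxwellPhaseMeasure β u Λ) {x | HardCoreIn 1 Λ (superposeIn Λ x ∅)}) := by
  rw [Literature.MathematicalPhysics.KineticTheory.HardSphereDLR.gibbsSpecMeasure, Measure.smul_apply, smul_eq_mul,
    gibbsWeightMeasure_apply 1 z β u hΛ ∅ (measurableSet_countUniv_eq n), gibbsWeight_empty_countUniv_eq z β u hΛ n]

/-! ## The free volume after `j` insertions -/

/-- **Lower bound on the free volume**: whatever the `j` thrown points `x`, the a-priori mass of the new points `p`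
whose exclusion ball `B(p.1, 1) × ℝ³` contains no particle of the free superposition of `x` is at least
`vol Λ - j · 4π/3` (the union of the `j` unit balls around the thrown centres has volume `≤ j · 4π/3`,
`EuclideanSpace.volume_ball_fin_three`; the Maxwellian factor is a probability measure). -/
theorem ofReal_volume_sub_le_freeVolume {β : ℝ} (hβ : 0 < β) (u : V3) {Λ : Set V3} (hΛv : volume Λ ≠ ∞) {j : ℕ}
    (x : Fin j → V3 × V3) :
    ENNReal.ofReal ((volume Λ).toReal - 4 * Real.pi / 3 * j) ≤
      maxwellPhaseMeasure β u Λ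
        {p : V3 × V3 | (superposeIn Λ x ∅).count (Metric.ball p.1 1 ×ˢ (univ : Set V3)) = 0} := by
  haveI := isProbabilityMeasure_withDensity_maxwellianBeta hβ u
  set U : Set V3 := ⋃ i : Fin j, Metric.ball (x i).1 1 with hU
  have hUm : MeasurableSet U := MeasurableSet.iUnion fun i => Metric.isOpen_ball.measurableSet
  -- outside the balls the insertion is free
  have hsub : Uᶜ ×ˢ (univ : Set V3) ⊆
      {p : V3 × V3 | (superposeIn Λ x ∅).count (Metric.ball p.1 1 ×ˢ (univ : Set V3)) = 0} := by
    rintro p ⟨hpU, -⟩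
    rw [mem_setOf_eq, PointConfig.count, Set.encard_eq_zero, Set.eq_empty_iff_forall_notMem]
    rintro b ⟨hb, hbB, -⟩
    rcases (mem_superposeIn_iff Λ x ∅ b).1 hb with ⟨⟨i, rfl⟩, -⟩ | ⟨hb0, -⟩
    · refine hpU (mem_iUnion.2 ⟨i, ?_⟩)
      rw [Metric.mem_ball, dist_comm]
      exact hbB
    · exact notMem_emptyConfig_free b hb0
  -- the balls have total volume `≤ j · 4π/3`
  have hballs : volume U ≤ ENNReal.ofReal (4 * Real.pi / 3 * j) := by
    calc volume U ≤ ∑ i : Fin j, volume (Metric.ball (x i).1 1) := measure_iUnion_fintype_le _ _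
      _ = ∑ _i : Fin j, ENNReal.ofReal (4 * Real.pi / 3) := Finset.sum_congr rfl fun i _ => by
          rw [EuclideanSpace.volume_ball_fin_three, ENNReal.ofReal_one, one_pow, one_mul, mul_comm Real.pi 4]
      _ = ENNReal.ofReal (4 * Real.pi / 3 * j) := by
          rw [Finset.sum_const, Finset.card_univ, Fintype.card_fin, nsmul_eq_mul, mul_comm,
            ENNReal.ofReal_mul (by positivity), ENNReal.ofReal_natCast]
  calc ENNReal.ofReal ((volume Λ).toReal - 4 * Real.pi / 3 * j)
      = volume Λ - ENNReal.ofReal (4 * Real.pi / 3 * j) := by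
        rw [ENNReal.ofReal_sub _ (by positivity), ENNReal.ofReal_toReal hΛv]
    _ ≤ volume (Uᶜ ∩ Λ) := by
        rw [tsub_le_iff_right]
        calc volume Λ ≤ volume ((Uᶜ ∩ Λ) ∪ U) := measure_mono fun q hq => by
              by_cases hqU : q ∈ U
              · exact Or.inr hqU
              · exact Or.inl ⟨hqU, hq⟩
          _ ≤ volume (Uᶜ ∩ Λ) + volume U := measure_union_le _ _
          _ ≤ volume (Uᶜ ∩ Λ) + ENNReal.ofReal (4 * Real.pi / 3 * j) := add_le_add le_rfl hballs
    _ = maxwellPhaseMeasure β u Λ (Uᶜ ×ˢ (univ : Set V3)) := by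
        rw [maxwellPhaseMeasure_eq_prod, Measure.prod_prod, Measure.restrict_apply hUm.compl, measure_univ, mul_one]
    _ ≤ _ := measure_mono hsub

/-- **Inserting one particle, lower bound**: `(vol Λ - (4π/3) j)⁺ · m^{⊗j}{hard core} ≤ m^{⊗(j+1)}{hard core}` (the
insertion identity `pi_hardCore_succ_eq` and the free-volume bound `ofReal_volume_sub_le_freeVolume`). -/
theorem ofReal_volume_sub_mul_pi_hardCore_le_succ {β : ℝ} (hβ : 0 < β) (u : V3) {Λ : Set V3} (hΛ : MeasurableSet Λ)
    (hΛv : volume Λ ≠ ∞) (j : ℕ) :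
    ENNReal.ofReal ((volume Λ).toReal - 4 * Real.pi / 3 * j) *
        (Measure.pi fun _ : Fin j => maxwellPhaseMeasure β u Λ) {x | HardCoreIn 1 Λ (superposeIn Λ x ∅)} ≤
      (Measure.pi fun _ : Fin (j + 1) => maxwellPhaseMeasure β u Λ) {x | HardCoreIn 1 Λ (superposeIn Λ x ∅)} := by
  rw [pi_hardCore_succ_eq 1 β u hΛ ∅ j, ← setLIntegral_const]
  exact lintegral_mono fun x => ofReal_volume_sub_le_freeVolume hβ u hΛv x

/-- The activity bookkeeping: `(z w/(j+1)) · zʲ/j! = w · z^{j+1}/(j+1)!` in `ℝ≥0∞`, for `z, w ≥ 0`. -/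
theorem ofReal_mul_div_succ_mul_ofReal_pow_div_factorial {z w : ℝ} (hz : 0 ≤ z) (hw : 0 ≤ w) (j : ℕ) :
    ENNReal.ofReal (z * w / (j + 1)) * ENNReal.ofReal (z ^ j / (Nat.factorial j)) =
      ENNReal.ofReal w * ENNReal.ofReal (z ^ (j + 1) / (Nat.factorial (j + 1))) := by
  rw [← ENNReal.ofReal_mul (by positivity), ← ENNReal.ofReal_mul hw]
  congr 1
  rw [Nat.factorial_succ, Nat.cast_mul, Nat.cast_succ, pow_succ]
  have hf : (0 : ℝ) < (Nat.factorial j : ℕ) := by positivity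
  have hj : (0 : ℝ) < (j : ℝ) + 1 := by positivity
  field_simp

/-! ## The registered stub -/

/-- Registered stub `c9_free_count_succ_ratio_bounds` (line `FirstLemma`, piece (B3)): **insertion-ratio bounds for the
particle number under the free hard-sphere measure.** For the free finite-volume grand-canonical law
`γ = gibbsSpecMeasure 1 z β u Λ ∅` of a bounded measurable window `Λ` (`z, β > 0`) and `p_j = γ{N = j}`,
`z (vol Λ - (4π/3) j) / (j+1) · p_j ≤ p_{j+1} ≤ z vol Λ / (j+1) · p_j` (the lower bound being read as `0 ≤ p_{j+1}` when
`vol Λ < (4π/3) j`, `ENNReal.ofReal` of a negative number being `0`). Proof: `p_j = W⁻¹ (zʲ/j!) I_j`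
(`gibbsSpecMeasure_empty_countUniv_eq`) with `(vol Λ - (4π/3) j)⁺ I_j ≤ I_{j+1} ≤ vol Λ · I_j`
(`ofReal_volume_sub_mul_pi_hardCore_le_succ`, `pi_hardCore_succ_le`). -/
theorem c9_free_count_succ_ratio_bounds {z β : ℝ} {u : V3} (hz : 0 < z) (hβ : 0 < β) {Λ : Set V3} (hΛ : MeasurableSet Λ)
    (hΛb : Bornology.IsBounded Λ) (j : ℕ) :
    ENNReal.ofReal (z * ((volume Λ).toReal - 4 * Real.pi / 3 * j) / (j + 1)) *
        gibbsSpecMeasure 1 z β u Λ ∅ {ω | ω.count univ = j} ≤ gibbsSpecMeasure 1 z β u Λ ∅ {ω | ω.count univ = (j + 1 : ℕ)} ∧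
      gibbsSpecMeasure 1 z β u Λ ∅ {ω | ω.count univ = (j + 1 : ℕ)} ≤
        ENNReal.ofReal (z * (volume Λ).toReal / (j + 1)) * gibbsSpecMeasure 1 z β u Λ ∅ {ω | ω.count univ = j} := by
  haveI := sigmaFinite_maxwellPhaseMeasure β u Λ
  have hΛv : volume Λ ≠ ∞ := hΛb.measure_lt_top.ne
  set W : ℝ≥0∞ := gibbsWeight 1 z β u Λ ∅ univ with hW
  set P : ℕ → ℝ≥0∞ := fun k =>
    (Measure.pi fun _ : Fin k => maxwellPhaseMeasure β u Λ) {x | HardCoreIn 1 Λ (superposeIn Λ x ∅)} with hP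
  set c : ℕ → ℝ≥0∞ := fun k => ENNReal.ofReal (z ^ k / (Nat.factorial k)) with hc
  have hR : ∀ n : ℕ, gibbsSpecMeasure 1 z β u Λ ∅ {ω | ω.count univ = (n : ℕ∞)} = W⁻¹ * (c n * P n) := fun n =>
    gibbsSpecMeasure_empty_countUniv_eq z β u hΛ n
  have hup : P (j + 1) ≤ volume Λ * P j := by
    have h := pi_hardCore_succ_le (maxwellPhaseMeasure β u Λ) 1 Λ (∅ : PointConfig (V3 × V3)) j
    rwa [maxwellPhaseMeasure_univ hβ u Λ] at h
  have hlow : ENNReal.ofReal ((volume Λ).toReal - 4 * Real.pi / 3 * j) * P j ≤ P (j + 1) :=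
    ofReal_volume_sub_mul_pi_hardCore_le_succ hβ u hΛ hΛv j
  rw [hR j, hR (j + 1)]
  refine ⟨?_, ?_⟩
  · rcases le_or_gt 0 ((volume Λ).toReal - 4 * Real.pi / 3 * j) with hw | hw
    · calc ENNReal.ofReal (z * ((volume Λ).toReal - 4 * Real.pi / 3 * j) / (j + 1)) * (W⁻¹ * (c j * P j))
          = W⁻¹ * (ENNReal.ofReal (z * ((volume Λ).toReal - 4 * Real.pi / 3 * j) / (j + 1)) * c j * P j) := by ring
        _ = W⁻¹ * (c (j + 1) * (ENNReal.ofReal ((volume Λ).toReal - 4 * Real.pi / 3 * j) * P j)) := by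
            rw [hc]
            dsimp only
            rw [ofReal_mul_div_succ_mul_ofReal_pow_div_factorial hz.le hw j]
            ring
        _ ≤ W⁻¹ * (c (j + 1) * P (j + 1)) := mul_le_mul' le_rfl (mul_le_mul' le_rfl hlow)
    · rw [ENNReal.ofReal_of_nonpos (div_nonpos_of_nonpos_of_nonneg (mul_nonpos_of_nonneg_of_nonpos hz.le hw.le)
        (by positivity)), zero_mul]
      exact zero_le
  · calc W⁻¹ * (c (j + 1) * P (j + 1)) ≤ W⁻¹ * (c (j + 1) * (volume Λ * P j)) :=
          mul_le_mul' le_rfl (mul_le_mul' le_rfl hup)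
      _ = W⁻¹ * (ENNReal.ofReal (volume Λ).toReal * c (j + 1) * P j) := by rw [ENNReal.ofReal_toReal hΛv]; ring
      _ = W⁻¹ * (ENNReal.ofReal (z * (volume Λ).toReal / (j + 1)) * c j * P j) := by
          rw [hc]
          dsimp only
          rw [ofReal_mul_div_succ_mul_ofReal_pow_div_factorial hz.le ENNReal.toReal_nonneg j]
      _ = ENNReal.ofReal (z * (volume Λ).toReal / (j + 1)) * (W⁻¹ * (c j * P j)) := by ring

end Summit.AtomisticToContinuum.HydrodynamicLimit.Theorems.KiferCompactification

end
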